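import Summits.HubbardSuperconductivity.HubbardSuperconductivity.Theorems.WeakCouplingBCSKlLindhardEnclosureHyperbolaCore

/-!
# KL-MARGIN-SCAN reader (22) «kernel-lindhard-enclosure» — the majorised-hyperbola ceiling: variants B and A ON THE KERNEL DATA

Instantiation of `…HyperbolaCore.hyperbolaB_core` / `hyperbolaA_core` on a guarded, oriented single-straddle cell inside the root square,
for both positions of the straddler (`sh = true`: `p + q` straddles, far point `p` with status `far`; `sh = false`: `p` straddles, far
point `p + q`): the kernel's variant values
`vB = cdivZ (2^30·dzx·10⁴·logUpZ (cdivZ (SminA·LB) Vlo)) (U·τy·SminA)` and `vA = cdivZ (2^30·dzy·10⁴·logUpZ (cdivZ (SminB·LA) Vlo)) (U·τx·SminB)`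
(`SminA = min sDnZ α-ends`, `SminB = min sDnZ β-ends`, `LB/LA = extentZ …`, `Vlo = distLoZ far`) are certified ceilings of the cell whenever
the corresponding lower sine hint is checked and positive and the slope records at the range ends are positive (`piecesOK`).  Also the
SWAPPED domination lemmas (`dom_sh_swap`, `dom_nsh_swap`: crescent in the abscissa cosine, via `band_symm`).  Honest framing: nothing in this
file asserts a KL margin at any `t′ ≠ 0`, `K₃`, `U₀`, the window or B1g dominance; a Kohn–Luttinger instability statement is not ODLRO and
nothing here proves superconductivity in the Hubbard model.  (p1 g26, 2026-08-29.)
-/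

noncomputable section

set_option linter.dupNamespace false

namespace Summit.HubbardSuperconductivity.HubbardSuperconductivity.Theorems.KlLindhardEnclosure

open Real Set MeasureTheory Literature.MathematicalPhysics.QuantumLattice
open Summit.HubbardSuperconductivity.HubbardSuperconductivity.Theorems
open Summit.HubbardSuperconductivity.HubbardSuperconductivity.Theorems.KlStair (bandR)

/-! ## §1 Swapped domination (crescent in the abscissa cosine) -/

/-- **DOMINATION, straddler `p + q`, crescent in the ABSCISSA cosine**: `F(pt x y) ≤ cres (!far) (cresPos far αlo' αhi' (cos (y + q₂/U)))
SminB V (cos (x + q₁/U))` with `SminB = min(sDnZ bLo', sDnZ bUp')/2^40`. -/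
theorem Params.dom_sh_swap (P : Params) (hP : P.admissible = true) {a b c d : ℤ} (hin : P.InRoot a b c d) (far : Bool)
    (hg : (P.cell (P.mkX a) (P.mkX b) (P.mkY c) (P.mkY d)).guards = true)
    (hs1 : P.status (P.cell (P.mkX a) (P.mkX b) (P.mkY c) (P.mkY d)).e1Lo (P.cell (P.mkX a) (P.mkX b) (P.mkY c) (P.mkY d)).e1Hi = some far)
    (hsLo : 0 < P.sDnZ (P.cell (P.mkX a) (P.mkX b) (P.mkY c) (P.mkY d)).bLo')
    (hsUp : 0 < P.sDnZ (P.cell (P.mkX a) (P.mkX b) (P.mkY c) (P.mkY d)).bUp')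
    (hV : 0 < P.distLoZ (P.cell (P.mkX a) (P.mkX b) (P.mkY c) (P.mkY d)).e1Lo (P.cell (P.mkX a) (P.mkX b) (P.mkY c) (P.mkY d)).e1Hi)
    {x y : ℝ} (hx : x ∈ Icc ((a : ℝ) / (P.U : ℝ)) ((b : ℝ) / (P.U : ℝ))) (hy : y ∈ Icc ((c : ℝ) / (P.U : ℝ)) ((d : ℝ) / (P.U : ℝ))) :
    P.integrand (pt x y) ≤ cres (!far)
      (P.cresPos far ((((P.cell (P.mkX a) (P.mkX b) (P.mkY c) (P.mkY d)).aLo' : ℤ) : ℝ) / 2 ^ 40)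
        ((((P.cell (P.mkX a) (P.mkX b) (P.mkY c) (P.mkY d)).aUp' : ℤ) : ℝ) / 2 ^ 40) (Real.cos (y + (P.q2z : ℝ) / (P.U : ℝ))))
      (((min (P.sDnZ (P.cell (P.mkX a) (P.mkX b) (P.mkY c) (P.mkY d)).bLo') (P.sDnZ (P.cell (P.mkX a) (P.mkX b) (P.mkY c) (P.mkY d)).bUp') : ℤ) : ℝ) / 2 ^ 40)
      (((P.distLoZ (P.cell (P.mkX a) (P.mkX b) (P.mkY c) (P.mkY d)).e1Lo (P.cell (P.mkX a) (P.mkX b) (P.mkY c) (P.mkY d)).e1Hi : ℤ) : ℝ) / 2 ^ 40)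
      (Real.cos (x + (P.q1z : ℝ) / (P.U : ℝ))) := by
  obtain ⟨htpD, hmuD, hU, -, -⟩ := P.admissible_facts hP
  obtain ⟨ha, -, -, hb, hc, -, -, hd⟩ := id hin
  obtain ⟨α1, α2⟩ := P.cell_cosx'_mem hP (c := c) (d := d) ha hb hx.1 hx.2
  obtain ⟨β1, β2⟩ := P.cell_cosy'_mem hP (a := a) (b := b) hc hd hy.1 hy.2
  obtain ⟨hSmin, hSminle, hS⟩ := P.sMin_facts htpD hsLo hsUp β1 β2
  obtain ⟨e1l, e1h⟩ := P.cell_band_mem_Icc hP hin hg hx hy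
  have hVef := P.distLoZ_le hmuD e1l e1h
  have hVpos : (0 : ℝ) < ((P.distLoZ (P.cell (P.mkX a) (P.mkX b) (P.mkY c) (P.mkY d)).e1Lo
      (P.cell (P.mkX a) (P.mkX b) (P.mkY c) (P.mkY d)).e1Hi : ℤ) : ℝ) / 2 ^ 40 :=
    div_pos (by exact_mod_cast hV) (by positivity)
  have hfar : (P.band (pt x y) < (P.muN : ℝ) / (P.muD : ℝ)) ↔ far = true := by
    rw [← P.cast_mu]
    cases far with
    | true => exact ⟨fun _ => rfl, fun _ => lt_of_le_of_lt e1h (P.status_true_lt hmuD hs1)⟩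
    | false => exact ⟨fun h => absurd h (not_lt.mpr ((P.status_false_le hmuD hs1).trans e1l)), fun h => by simp at h⟩
  have key := P.dom_point far hS hSmin hSminle hVpos (by rw [← P.cast_mu]; exact hVef) hfar ⟨α1, α2⟩
  rw [P.integrand_eq_ite, P.band_pt_shift, band_symm, P.cast_mu]
  exact key

/-- **DOMINATION, straddler `p`, crescent in the ABSCISSA cosine**: `F(pt x y) ≤ cres (!far) (cresPos far αlo αhi (cos y)) SminB V (cos (x + 0))`. -/
theorem Params.dom_nsh_swap (P : Params) (hP : P.admissible = true) {a b c d : ℤ} (hin : P.InRoot a b c d) (far : Bool)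
    (hg : (P.cell (P.mkX a) (P.mkX b) (P.mkY c) (P.mkY d)).guards = true)
    (hs2 : P.status (P.cell (P.mkX a) (P.mkX b) (P.mkY c) (P.mkY d)).e2Lo (P.cell (P.mkX a) (P.mkX b) (P.mkY c) (P.mkY d)).e2Hi = some far)
    (hsLo : 0 < P.sDnZ (P.cell (P.mkX a) (P.mkX b) (P.mkY c) (P.mkY d)).bLo)
    (hsUp : 0 < P.sDnZ (P.cell (P.mkX a) (P.mkX b) (P.mkY c) (P.mkY d)).bUp)
    (hV : 0 < P.distLoZ (P.cell (P.mkX a) (P.mkX b) (P.mkY c) (P.mkY d)).e2Lo (P.cell (P.mkX a) (P.mkX b) (P.mkY c) (P.mkY d)).e2Hi)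
    {x y : ℝ} (hx : x ∈ Icc ((a : ℝ) / (P.U : ℝ)) ((b : ℝ) / (P.U : ℝ))) (hy : y ∈ Icc ((c : ℝ) / (P.U : ℝ)) ((d : ℝ) / (P.U : ℝ))) :
    P.integrand (pt x y) ≤ cres (!far)
      (P.cresPos far ((((P.cell (P.mkX a) (P.mkX b) (P.mkY c) (P.mkY d)).aLo : ℤ) : ℝ) / 2 ^ 40)
        ((((P.cell (P.mkX a) (P.mkX b) (P.mkY c) (P.mkY d)).aUp : ℤ) : ℝ) / 2 ^ 40) (Real.cos y))
      (((min (P.sDnZ (P.cell (P.mkX a) (P.mkX b) (P.mkY c) (P.mkY d)).bLo) (P.sDnZ (P.cell (P.mkX a) (P.mkX b) (P.mkY c) (P.mkY d)).bUp) : ℤ) : ℝ) / 2 ^ 40)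
      (((P.distLoZ (P.cell (P.mkX a) (P.mkX b) (P.mkY c) (P.mkY d)).e2Lo (P.cell (P.mkX a) (P.mkX b) (P.mkY c) (P.mkY d)).e2Hi : ℤ) : ℝ) / 2 ^ 40)
      (Real.cos (x + 0)) := by
  obtain ⟨htpD, hmuD, hU, -, -⟩ := P.admissible_facts hP
  obtain ⟨ha, -, -, hb, hc, -, -, hd⟩ := id hin
  obtain ⟨α1, α2⟩ := P.cell_cosx_mem hP (c := c) (d := d) ha hb hx.1 hx.2
  obtain ⟨β1, β2⟩ := P.cell_cosy_mem hP (a := a) (b := b) hc hd hy.1 hy.2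
  obtain ⟨hSmin, hSminle, hS⟩ := P.sMin_facts htpD hsLo hsUp β1 β2
  obtain ⟨e2l, e2h⟩ := P.cell_band_shift_mem_Icc hP hin hg hx hy
  have hVef := P.distLoZ_le hmuD e2l e2h
  have hVpos : (0 : ℝ) < ((P.distLoZ (P.cell (P.mkX a) (P.mkX b) (P.mkY c) (P.mkY d)).e2Lo
      (P.cell (P.mkX a) (P.mkX b) (P.mkY c) (P.mkY d)).e2Hi : ℤ) : ℝ) / 2 ^ 40 :=
    div_pos (by exact_mod_cast hV) (by positivity)
  have hfar : (P.band (pt x y + P.qv) < (P.muN : ℝ) / (P.muD : ℝ)) ↔ far = true := by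
    rw [← P.cast_mu]
    cases far with
    | true => exact ⟨fun _ => rfl, fun _ => lt_of_le_of_lt e2h (P.status_true_lt hmuD hs2)⟩
    | false => exact ⟨fun h => absurd h (not_lt.mpr ((P.status_false_le hmuD hs2).trans e2l)), fun h => by simp at h⟩
  have key := P.dom_point far hS hSmin hSminle hVpos (by rw [← P.cast_mu]; exact hVef) hfar ⟨α1, α2⟩
  rw [add_zero, P.integrand_eq_ite_symm, P.band_pt, band_symm, P.cast_mu]
  exact key

/-! ## §2 Variant B on the kernel data -/

/-- **`vB` is sound, straddler `p + q`.** -/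
theorem Params.vB_sh_valid (P : Params) (hP : P.admissible = true) {a b c d : ℤ} (hin : P.InRoot a b c d) (hab : a < b) (hcd : c < d)
    (far : Bool) (hg : (P.cell (P.mkX a) (P.mkX b) (P.mkY c) (P.mkY d)).guards = true)
    (hs1 : P.status (P.cell (P.mkX a) (P.mkX b) (P.mkY c) (P.mkY d)).e1Lo (P.cell (P.mkX a) (P.mkX b) (P.mkY c) (P.mkY d)).e1Hi = some far)
    (hsLo : 0 < P.sDnZ (P.cell (P.mkX a) (P.mkX b) (P.mkY c) (P.mkY d)).aLo')
    (hsUp : 0 < P.sDnZ (P.cell (P.mkX a) (P.mkX b) (P.mkY c) (P.mkY d)).aUp')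
    (hV : 0 < P.distLoZ (P.cell (P.mkX a) (P.mkX b) (P.mkY c) (P.mkY d)).e1Lo (P.cell (P.mkX a) (P.mkX b) (P.mkY c) (P.mkY d)).e1Hi)
    {τy : ℕ} (hτ : 0 < τy)
    (hok : sinLoOK (P.cell (P.mkX a) (P.mkX b) (P.mkY c) (P.mkY d)).bLo' (P.cell (P.mkX a) (P.mkX b) (P.mkY c) (P.mkY d)).bUp' τy = true) :
    P.CeilValid a b c d (cdivZ (2 ^ 30 * (b - a) * 10 ^ 4 * logUpZ (cdivZ
      (min (P.sDnZ (P.cell (P.mkX a) (P.mkX b) (P.mkY c) (P.mkY d)).aLo') (P.sDnZ (P.cell (P.mkX a) (P.mkX b) (P.mkY c) (P.mkY d)).aUp') *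
        P.extentZ far (P.cell (P.mkX a) (P.mkX b) (P.mkY c) (P.mkY d)).aLo' (P.cell (P.mkX a) (P.mkX b) (P.mkY c) (P.mkY d)).aUp'
          (P.cell (P.mkX a) (P.mkX b) (P.mkY c) (P.mkY d)).bLo' (P.cell (P.mkX a) (P.mkX b) (P.mkY c) (P.mkY d)).bUp')
      (P.distLoZ (P.cell (P.mkX a) (P.mkX b) (P.mkY c) (P.mkY d)).e1Lo (P.cell (P.mkX a) (P.mkX b) (P.mkY c) (P.mkY d)).e1Hi)))
      (P.U * (τy : ℤ) * min (P.sDnZ (P.cell (P.mkX a) (P.mkX b) (P.mkY c) (P.mkY d)).aLo') (P.sDnZ (P.cell (P.mkX a) (P.mkX b) (P.mkY c) (P.mkY d)).aUp'))) := by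
  obtain ⟨htpD, hmuD, hU, -, -⟩ := P.admissible_facts hP
  obtain ⟨ha, -, -, hb, hc, -, -, hd⟩ := id hin
  have hspLo := P.sPos_of_sDnZ_pos htpD hsLo
  have hspUp := P.sPos_of_sDnZ_pos htpD hsUp
  have hext0 : 0 ≤ P.extentZ far (P.cell (P.mkX a) (P.mkX b) (P.mkY c) (P.mkY d)).aLo' (P.cell (P.mkX a) (P.mkX b) (P.mkY c) (P.mkY d)).aUp'
      (P.cell (P.mkX a) (P.mkX b) (P.mkY c) (P.mkY d)).bLo' (P.cell (P.mkX a) (P.mkX b) (P.mkY c) (P.mkY d)).bUp' := by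
    unfold Params.extentZ; exact le_max_left _ _
  refine P.hyperbolaB_core hP hab hcd far (βLo := (P.cell (P.mkX a) (P.mkX b) (P.mkY c) (P.mkY d)).bLo') (βUp := (P.cell (P.mkX a) (P.mkX b) (P.mkY c) (P.mkY d)).bUp') (s := (P.q2z : ℝ) / (P.U : ℝ))
    (m := fun x => P.cresPos far ((((P.cell (P.mkX a) (P.mkX b) (P.mkY c) (P.mkY d)).bLo' : ℤ) : ℝ) / 2 ^ 40)
      ((((P.cell (P.mkX a) (P.mkX b) (P.mkY c) (P.mkY d)).bUp' : ℤ) : ℝ) / 2 ^ 40) (Real.cos (x + (P.q1z : ℝ) / (P.U : ℝ))))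
    (lt_min hsLo hsUp) hV hext0 hτ ?_ ?_ ?_
  · intro x hx y hy; exact P.dom_sh hP hin far hg hs1 hsLo hsUp hV hx hy
  · intro y hy
    obtain ⟨β1, β2⟩ := P.cell_cosy'_mem hP (a := a) (b := b) hc hd hy.1 hy.2
    exact ⟨⟨β1, β2⟩, le_abs_sin_of_sinLoOK hok β1 β2⟩
  · intro x hx
    obtain ⟨α1, α2⟩ := P.cell_cosx'_mem hP (c := c) (d := d) ha hb hx.1 hx.2
    exact (P.extent_le hP far hspLo hspUp α1 α2).2

/-- **`vB` is sound, straddler `p`.** -/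
theorem Params.vB_nsh_valid (P : Params) (hP : P.admissible = true) {a b c d : ℤ} (hin : P.InRoot a b c d) (hab : a < b) (hcd : c < d)
    (far : Bool) (hg : (P.cell (P.mkX a) (P.mkX b) (P.mkY c) (P.mkY d)).guards = true)
    (hs2 : P.status (P.cell (P.mkX a) (P.mkX b) (P.mkY c) (P.mkY d)).e2Lo (P.cell (P.mkX a) (P.mkX b) (P.mkY c) (P.mkY d)).e2Hi = some far)
    (hsLo : 0 < P.sDnZ (P.cell (P.mkX a) (P.mkX b) (P.mkY c) (P.mkY d)).aLo)
    (hsUp : 0 < P.sDnZ (P.cell (P.mkX a) (P.mkX b) (P.mkY c) (P.mkY d)).aUp)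
    (hV : 0 < P.distLoZ (P.cell (P.mkX a) (P.mkX b) (P.mkY c) (P.mkY d)).e2Lo (P.cell (P.mkX a) (P.mkX b) (P.mkY c) (P.mkY d)).e2Hi)
    {τy : ℕ} (hτ : 0 < τy)
    (hok : sinLoOK (P.cell (P.mkX a) (P.mkX b) (P.mkY c) (P.mkY d)).bLo (P.cell (P.mkX a) (P.mkX b) (P.mkY c) (P.mkY d)).bUp τy = true) :
    P.CeilValid a b c d (cdivZ (2 ^ 30 * (b - a) * 10 ^ 4 * logUpZ (cdivZ
      (min (P.sDnZ (P.cell (P.mkX a) (P.mkX b) (P.mkY c) (P.mkY d)).aLo) (P.sDnZ (P.cell (P.mkX a) (P.mkX b) (P.mkY c) (P.mkY d)).aUp) *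
        P.extentZ far (P.cell (P.mkX a) (P.mkX b) (P.mkY c) (P.mkY d)).aLo (P.cell (P.mkX a) (P.mkX b) (P.mkY c) (P.mkY d)).aUp
          (P.cell (P.mkX a) (P.mkX b) (P.mkY c) (P.mkY d)).bLo (P.cell (P.mkX a) (P.mkX b) (P.mkY c) (P.mkY d)).bUp)
      (P.distLoZ (P.cell (P.mkX a) (P.mkX b) (P.mkY c) (P.mkY d)).e2Lo (P.cell (P.mkX a) (P.mkX b) (P.mkY c) (P.mkY d)).e2Hi)))
      (P.U * (τy : ℤ) * min (P.sDnZ (P.cell (P.mkX a) (P.mkX b) (P.mkY c) (P.mkY d)).aLo) (P.sDnZ (P.cell (P.mkX a) (P.mkX b) (P.mkY c) (P.mkY d)).aUp))) := by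
  obtain ⟨htpD, hmuD, hU, -, -⟩ := P.admissible_facts hP
  obtain ⟨ha, -, -, hb, hc, -, -, hd⟩ := id hin
  have hspLo := P.sPos_of_sDnZ_pos htpD hsLo
  have hspUp := P.sPos_of_sDnZ_pos htpD hsUp
  have hext0 : 0 ≤ P.extentZ far (P.cell (P.mkX a) (P.mkX b) (P.mkY c) (P.mkY d)).aLo (P.cell (P.mkX a) (P.mkX b) (P.mkY c) (P.mkY d)).aUp
      (P.cell (P.mkX a) (P.mkX b) (P.mkY c) (P.mkY d)).bLo (P.cell (P.mkX a) (P.mkX b) (P.mkY c) (P.mkY d)).bUp := by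
    unfold Params.extentZ; exact le_max_left _ _
  refine P.hyperbolaB_core hP hab hcd far (βLo := (P.cell (P.mkX a) (P.mkX b) (P.mkY c) (P.mkY d)).bLo) (βUp := (P.cell (P.mkX a) (P.mkX b) (P.mkY c) (P.mkY d)).bUp) (s := 0)
    (m := fun x => P.cresPos far ((((P.cell (P.mkX a) (P.mkX b) (P.mkY c) (P.mkY d)).bLo : ℤ) : ℝ) / 2 ^ 40)
      ((((P.cell (P.mkX a) (P.mkX b) (P.mkY c) (P.mkY d)).bUp : ℤ) : ℝ) / 2 ^ 40) (Real.cos x))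
    (lt_min hsLo hsUp) hV hext0 hτ ?_ ?_ ?_
  · intro x hx y hy; exact P.dom_nsh hP hin far hg hs2 hsLo hsUp hV hx hy
  · intro y hy
    obtain ⟨β1, β2⟩ := P.cell_cosy_mem hP (a := a) (b := b) hc hd hy.1 hy.2
    rw [add_zero]
    exact ⟨⟨β1, β2⟩, le_abs_sin_of_sinLoOK hok β1 β2⟩
  · intro x hx
    obtain ⟨α1, α2⟩ := P.cell_cosx_mem hP (c := c) (d := d) ha hb hx.1 hx.2
    exact (P.extent_le hP far hspLo hspUp α1 α2).2

/-! ## §3 Variant A on the kernel data -/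

/-- **`vA` is sound, straddler `p + q`.** -/
theorem Params.vA_sh_valid (P : Params) (hP : P.admissible = true) {a b c d : ℤ} (hin : P.InRoot a b c d) (hab : a < b) (hcd : c < d)
    (far : Bool) (hg : (P.cell (P.mkX a) (P.mkX b) (P.mkY c) (P.mkY d)).guards = true)
    (hs1 : P.status (P.cell (P.mkX a) (P.mkX b) (P.mkY c) (P.mkY d)).e1Lo (P.cell (P.mkX a) (P.mkX b) (P.mkY c) (P.mkY d)).e1Hi = some far)
    (hsLo : 0 < P.sDnZ (P.cell (P.mkX a) (P.mkX b) (P.mkY c) (P.mkY d)).bLo')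
    (hsUp : 0 < P.sDnZ (P.cell (P.mkX a) (P.mkX b) (P.mkY c) (P.mkY d)).bUp')
    (hV : 0 < P.distLoZ (P.cell (P.mkX a) (P.mkX b) (P.mkY c) (P.mkY d)).e1Lo (P.cell (P.mkX a) (P.mkX b) (P.mkY c) (P.mkY d)).e1Hi)
    {τx : ℕ} (hτ : 0 < τx)
    (hok : sinLoOK (P.cell (P.mkX a) (P.mkX b) (P.mkY c) (P.mkY d)).aLo' (P.cell (P.mkX a) (P.mkX b) (P.mkY c) (P.mkY d)).aUp' τx = true) :
    P.CeilValid a b c d (cdivZ (2 ^ 30 * (d - c) * 10 ^ 4 * logUpZ (cdivZ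
      (min (P.sDnZ (P.cell (P.mkX a) (P.mkX b) (P.mkY c) (P.mkY d)).bLo') (P.sDnZ (P.cell (P.mkX a) (P.mkX b) (P.mkY c) (P.mkY d)).bUp') *
        P.extentZ far (P.cell (P.mkX a) (P.mkX b) (P.mkY c) (P.mkY d)).bLo' (P.cell (P.mkX a) (P.mkX b) (P.mkY c) (P.mkY d)).bUp'
          (P.cell (P.mkX a) (P.mkX b) (P.mkY c) (P.mkY d)).aLo' (P.cell (P.mkX a) (P.mkX b) (P.mkY c) (P.mkY d)).aUp')
      (P.distLoZ (P.cell (P.mkX a) (P.mkX b) (P.mkY c) (P.mkY d)).e1Lo (P.cell (P.mkX a) (P.mkX b) (P.mkY c) (P.mkY d)).e1Hi)))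
      (P.U * (τx : ℤ) * min (P.sDnZ (P.cell (P.mkX a) (P.mkX b) (P.mkY c) (P.mkY d)).bLo') (P.sDnZ (P.cell (P.mkX a) (P.mkX b) (P.mkY c) (P.mkY d)).bUp'))) := by
  obtain ⟨htpD, hmuD, hU, -, -⟩ := P.admissible_facts hP
  obtain ⟨ha, -, -, hb, hc, -, -, hd⟩ := id hin
  have hspLo := P.sPos_of_sDnZ_pos htpD hsLo
  have hspUp := P.sPos_of_sDnZ_pos htpD hsUp
  have hext0 : 0 ≤ P.extentZ far (P.cell (P.mkX a) (P.mkX b) (P.mkY c) (P.mkY d)).bLo' (P.cell (P.mkX a) (P.mkX b) (P.mkY c) (P.mkY d)).bUp'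
      (P.cell (P.mkX a) (P.mkX b) (P.mkY c) (P.mkY d)).aLo' (P.cell (P.mkX a) (P.mkX b) (P.mkY c) (P.mkY d)).aUp' := by
    unfold Params.extentZ; exact le_max_left _ _
  refine P.hyperbolaA_core hP hab hcd far (αLo := (P.cell (P.mkX a) (P.mkX b) (P.mkY c) (P.mkY d)).aLo') (αUp := (P.cell (P.mkX a) (P.mkX b) (P.mkY c) (P.mkY d)).aUp') (s := (P.q1z : ℝ) / (P.U : ℝ))
    (m := fun y => P.cresPos far ((((P.cell (P.mkX a) (P.mkX b) (P.mkY c) (P.mkY d)).aLo' : ℤ) : ℝ) / 2 ^ 40)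
      ((((P.cell (P.mkX a) (P.mkX b) (P.mkY c) (P.mkY d)).aUp' : ℤ) : ℝ) / 2 ^ 40) (Real.cos (y + (P.q2z : ℝ) / (P.U : ℝ))))
    (lt_min hsLo hsUp) hV hext0 hτ ?_ ?_ ?_
  · intro x hx y hy; exact P.dom_sh_swap hP hin far hg hs1 hsLo hsUp hV hx hy
  · intro x hx
    obtain ⟨α1, α2⟩ := P.cell_cosx'_mem hP (c := c) (d := d) ha hb hx.1 hx.2
    exact ⟨⟨α1, α2⟩, le_abs_sin_of_sinLoOK hok α1 α2⟩
  · intro y hy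
    obtain ⟨β1, β2⟩ := P.cell_cosy'_mem hP (a := a) (b := b) hc hd hy.1 hy.2
    exact (P.extent_le hP far hspLo hspUp β1 β2).2

/-- **`vA` is sound, straddler `p`.** -/
theorem Params.vA_nsh_valid (P : Params) (hP : P.admissible = true) {a b c d : ℤ} (hin : P.InRoot a b c d) (hab : a < b) (hcd : c < d)
    (far : Bool) (hg : (P.cell (P.mkX a) (P.mkX b) (P.mkY c) (P.mkY d)).guards = true)
    (hs2 : P.status (P.cell (P.mkX a) (P.mkX b) (P.mkY c) (P.mkY d)).e2Lo (P.cell (P.mkX a) (P.mkX b) (P.mkY c) (P.mkY d)).e2Hi = some far)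
    (hsLo : 0 < P.sDnZ (P.cell (P.mkX a) (P.mkX b) (P.mkY c) (P.mkY d)).bLo)
    (hsUp : 0 < P.sDnZ (P.cell (P.mkX a) (P.mkX b) (P.mkY c) (P.mkY d)).bUp)
    (hV : 0 < P.distLoZ (P.cell (P.mkX a) (P.mkX b) (P.mkY c) (P.mkY d)).e2Lo (P.cell (P.mkX a) (P.mkX b) (P.mkY c) (P.mkY d)).e2Hi)
    {τx : ℕ} (hτ : 0 < τx)
    (hok : sinLoOK (P.cell (P.mkX a) (P.mkX b) (P.mkY c) (P.mkY d)).aLo (P.cell (P.mkX a) (P.mkX b) (P.mkY c) (P.mkY d)).aUp τx = true) :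
    P.CeilValid a b c d (cdivZ (2 ^ 30 * (d - c) * 10 ^ 4 * logUpZ (cdivZ
      (min (P.sDnZ (P.cell (P.mkX a) (P.mkX b) (P.mkY c) (P.mkY d)).bLo) (P.sDnZ (P.cell (P.mkX a) (P.mkX b) (P.mkY c) (P.mkY d)).bUp) *
        P.extentZ far (P.cell (P.mkX a) (P.mkX b) (P.mkY c) (P.mkY d)).bLo (P.cell (P.mkX a) (P.mkX b) (P.mkY c) (P.mkY d)).bUp
          (P.cell (P.mkX a) (P.mkX b) (P.mkY c) (P.mkY d)).aLo (P.cell (P.mkX a) (P.mkX b) (P.mkY c) (P.mkY d)).aUp)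
      (P.distLoZ (P.cell (P.mkX a) (P.mkX b) (P.mkY c) (P.mkY d)).e2Lo (P.cell (P.mkX a) (P.mkX b) (P.mkY c) (P.mkY d)).e2Hi)))
      (P.U * (τx : ℤ) * min (P.sDnZ (P.cell (P.mkX a) (P.mkX b) (P.mkY c) (P.mkY d)).bLo) (P.sDnZ (P.cell (P.mkX a) (P.mkX b) (P.mkY c) (P.mkY d)).bUp))) := by
  obtain ⟨htpD, hmuD, hU, -, -⟩ := P.admissible_facts hP
  obtain ⟨ha, -, -, hb, hc, -, -, hd⟩ := id hin
  have hspLo := P.sPos_of_sDnZ_pos htpD hsLo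
  have hspUp := P.sPos_of_sDnZ_pos htpD hsUp
  have hext0 : 0 ≤ P.extentZ far (P.cell (P.mkX a) (P.mkX b) (P.mkY c) (P.mkY d)).bLo (P.cell (P.mkX a) (P.mkX b) (P.mkY c) (P.mkY d)).bUp
      (P.cell (P.mkX a) (P.mkX b) (P.mkY c) (P.mkY d)).aLo (P.cell (P.mkX a) (P.mkX b) (P.mkY c) (P.mkY d)).aUp := by
    unfold Params.extentZ; exact le_max_left _ _
  refine P.hyperbolaA_core hP hab hcd far (αLo := (P.cell (P.mkX a) (P.mkX b) (P.mkY c) (P.mkY d)).aLo) (αUp := (P.cell (P.mkX a) (P.mkX b) (P.mkY c) (P.mkY d)).aUp) (s := 0)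
    (m := fun y => P.cresPos far ((((P.cell (P.mkX a) (P.mkX b) (P.mkY c) (P.mkY d)).aLo : ℤ) : ℝ) / 2 ^ 40)
      ((((P.cell (P.mkX a) (P.mkX b) (P.mkY c) (P.mkY d)).aUp : ℤ) : ℝ) / 2 ^ 40) (Real.cos y))
    (lt_min hsLo hsUp) hV hext0 hτ ?_ ?_ ?_
  · intro x hx y hy; exact P.dom_nsh_swap hP hin far hg hs2 hsLo hsUp hV hx hy
  · intro x hx
    obtain ⟨α1, α2⟩ := P.cell_cosx_mem hP (c := c) (d := d) ha hb hx.1 hx.2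
    rw [add_zero]
    exact ⟨⟨α1, α2⟩, le_abs_sin_of_sinLoOK hok α1 α2⟩
  · intro y hy
    obtain ⟨β1, β2⟩ := P.cell_cosy_mem hP (a := a) (b := b) hc hd hy.1 hy.2
    exact (P.extent_le hP far hspLo hspUp β1 β2).2

end Summit.HubbardSuperconductivity.HubbardSuperconductivity.Theorems.KlLindhardEnclosure

end
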